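import Literature.RepresentationTheory.FiniteGroups.InducedInvariantsCharpolyQuotient
import Literature.RepresentationTheory.FiniteGroups.InducedDimension
import HarnessLib

/-!
# The Euler factor of an induced representation: the form for `σ ≃ Ind_φ π`

Topic `Literature/RepresentationTheory/FiniteGroups`, namespace `Literature.RepTheory`; the endpoint of
the series `InducedRecognition` → `InducedInvariantsCharpoly` → `InducedDimension` →
`InducedInvariantsCharpolyQuotient` (Artin 1931 §2 / Neukirch VII (10.4) (iv)).  The previous
files prove Artin's identity `det(1 - φt; V^{I}) = ∏ᵢ det(1 - φ'ᵢ t^{fᵢ}; W₀ ∩ V^{H ∩ τᵢ⁻¹Iτᵢ})`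
for a representation `V` of `G` that is induced *in Serre's sense* from an `H`-stable subspace
`W₀` (translates spanning, `dim V = [G:H] dim W₀`).  The tree's notion of an induced Artin
representation, `Literature.ArtinRep.IsInducedFrom ρ π`, is instead an equivalence
`ρ ≃ Representation.ind φ π` with Mathlib's induced module along the (injective) restriction
homomorphism `φ = absGaloisRestrict K M : Γ_M → Γ_K`.  This file performs the translation once
and for all, for arbitrary groups:

* `reverse_charpoly_restrict_invariants_eq_prod_of_equiv_ind` (**proved**): for
  `φ : G →* H` injective with image of finite index, finite-dimensional representations `π` of
  `G` on `A` and `σ` of `H` on `W` over a field of characteristic `0`, an equivalence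
  `e : σ ≃ ind φ π`, a normal subgroup `N ⊴ H` of finite index acting trivially through `σ`,
  subgroups `I ≤ D ≤ H` with `I` normal in `D`, `fr ∈ D` generating `D` modulo `I N`,
  representatives `τᵢ` of the double cosets `D \ H / φ(G)`, and elements `sᵢ ∈ G` with
  `φ(sᵢ) ∈ τᵢ⁻¹ fr^{fᵢ} I τᵢ`, `fᵢ` minimal:
  `det(1 - t σ(fr) | W^{I}) = ∏ᵢ det(1 - t^{fᵢ} π(sᵢ) | A^{φ⁻¹(τᵢ⁻¹ I τᵢ)})`.
  The subspace `W₀ = e⁻¹(1 ⊗ A)` of the previous files no longer appears: the factors live on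
  `A` (transport `charpoly_restrict_comap_eq` of `InducedDimension`), `N ≤ φ(G)` is derived
  (`mem_of_apply_eq_one`), and the degenerate case `A = 0` (where `N ≤ φ(G)` may fail) is
  treated separately (`charpoly_eq_one_of_finrank_eq_zero`).
* `mem_invariants_comap_of_mem_invariants`, `mem_invariants_of_mem_invariants_comap`,
  `mapsTo_inf_invariants_range` (**proved**): the `G`-map `i = e⁻¹ ∘ (a ↦ 1 ⊗ a) : A → W`
  identifies `A^{φ⁻¹ J}` with `i(A) ∩ W^{J}` for `J ≤ φ(G)`, compatibly with `π(x)` and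
  `σ(φ x)`.

For `H = Γ_K`, `G = Γ_M`, `σ = ρ`, `I ≤ D` inertia and decomposition group of a prime `𝔓 ∣ 𝔭`
of `\bar ℤ_K`, `fr` an arithmetic Frobenius, `N = ker ρ`, `τ_𝔮⁻¹ 𝔓 ↔ 𝔮 ∣ 𝔭` the primes of
`M`, `s_𝔮 ∈ Γ_M` a Frobenius at the corresponding prime of `\bar ℤ_M` and `f_𝔮 = f(𝔮|𝔭)`, the
right-hand factors are the Euler polynomials of `π` at the `𝔮 ∣ 𝔭` — Neukirch's
`det(1 - φt; V^{I_1}) = ∏ det(1 - φᵢ^{fᵢ} t^{fᵢ}; W^{I'ᵢ})` (VII, p. 524); the arithmetic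
identifications are not part of this file.  No definition is introduced (theorems only).

## References

* E. Artin, *Zur Theorie der L-Reihen mit allgemeinen Gruppencharakteren*, Abh. Math. Sem.
  Univ. Hamburg 8 (1931), §2 (`ArtinHamburg1931`).
* J. Neukirch, *Algebraic Number Theory* (1999), VII §10, Prop. (10.4) (iv) and its proof,
  pp. 522–524 (`NeukirchANT1999`).
* J.-P. Serre, *Linear Representations of Finite Groups*, GTM 42 (1977), §3.3, §7.1
  (`SerreLinearRepresentations1977`).
-/

namespace Literature.RepresentationTheory.FiniteGroups

open Representation

/-! ### Degenerate case: endomorphisms of the zero space -/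

section Degenerate

variable {k : Type*} [Field k] {V : Type*} [AddCommGroup V] [Module k V] [FiniteDimensional k V]

/-- The characteristic polynomial of an endomorphism of a zero-dimensional space is `1`
(it is monic of degree `dim = 0`). [folklore] -/
theorem charpoly_eq_one_of_finrank_eq_zero (h : Module.finrank k V = 0) (f : V →ₗ[k] V) :
    f.charpoly = 1 :=
  Polynomial.eq_one_of_monic_natDegree_zero f.charpoly_monic (by rw [f.charpoly_natDegree, h])

/-- On a zero-dimensional space every reversed characteristic polynomial of a restriction is
`1`. [folklore] -/
theorem reverse_charpoly_restrict_eq_one_of_finrank_eq_zero (h : Module.finrank k V = 0)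
    {p : Submodule k V} {f : V →ₗ[k] V} (hp : Set.MapsTo f p p) :
    (f.restrict hp).charpoly.reverse = 1 := by
  have hp0 : Module.finrank k p = 0 := Nat.eq_zero_of_le_zero (h ▸ p.finrank_le)
  rw [charpoly_eq_one_of_finrank_eq_zero hp0, ← Polynomial.C_1, Polynomial.reverse_C]

end Degenerate

/-! ### The `G`-map `i : A → W` and invariants -/

section Transport

variable {k : Type*} [Field k] {G H : Type*} [Group G] [Group H] (φ : G →* H)
  {A W : Type*} [AddCommGroup A] [Module k A] [AddCommGroup W] [Module k W]
  (π : Representation k G A) (σ : Representation k H W) (e : σ.Equiv (ind φ π))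

/-- For `J ≤ H` and `a ∈ A`: if `i(a) ∈ W^{J}` then `a ∈ A^{φ⁻¹ J}` (`i = e⁻¹ ∘ (a ↦ 1 ⊗ a)`
is injective for `φ` injective and intertwines `π` with `σ ∘ φ`).
[cite: SerreLinearRepresentations1977, §7.1] -/
theorem mem_invariants_comap_of_mem_invariants (hφ : Function.Injective φ) (J : Subgroup H)
    {a : A} (ha : (e.toLinearEquiv.symm.toLinearMap ∘ₗ IndV.mk φ π 1) a ∈
      invariants (σ.comp J.subtype)) :
    a ∈ invariants (π.comp (J.comap φ).subtype) := by
  rw [mem_invariants] at ha ⊢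
  rintro ⟨g, hg⟩
  apply comp_indV_mk_one_injective φ π σ e hφ
  exact (LinearMap.congr_fun (comp_indV_mk_one_intertwines φ π σ e g) a).trans
    (ha ⟨φ g, Subgroup.mem_comap.mp hg⟩)

/-- For `J ≤ φ(G)` and `a ∈ A^{φ⁻¹ J}`: `i(a) ∈ W^{J}`.
[cite: SerreLinearRepresentations1977, §7.1] -/
theorem mem_invariants_of_mem_invariants_comap (J : Subgroup H) (hJ : J ≤ φ.range) {a : A}
    (ha : a ∈ invariants (π.comp (J.comap φ).subtype)) :
    (e.toLinearEquiv.symm.toLinearMap ∘ₗ IndV.mk φ π 1) a ∈ invariants (σ.comp J.subtype) := by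
  rw [mem_invariants] at ha ⊢
  rintro ⟨j, hj⟩
  obtain ⟨g, rfl⟩ := hJ hj
  exact (LinearMap.congr_fun (comp_indV_mk_one_intertwines φ π σ e g) a).symm.trans
    (congrArg (e.toLinearEquiv.symm.toLinearMap ∘ₗ IndV.mk φ π 1) (ha ⟨g, Subgroup.mem_comap.mpr hj⟩))

/-- **Transport of stability.**  For `J ≤ φ(G)` and `x ∈ G` with `π(x)` preserving
`A^{φ⁻¹ J}`, the endomorphism `σ(φ x)` preserves `i(A) ∩ W^{J}`.
[cite: NeukirchANT1999, VII (10.4) (iv), proof] -/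
theorem mapsTo_inf_invariants_range (hφ : Function.Injective φ) (J : Subgroup H)
    (hJ : J ≤ φ.range) (x : G)
    (hx : Set.MapsTo (π x) ↑(invariants (π.comp (J.comap φ).subtype))
      ↑(invariants (π.comp (J.comap φ).subtype))) :
    Set.MapsTo (σ (φ x))
      ↑(LinearMap.range (e.toLinearEquiv.symm.toLinearMap ∘ₗ IndV.mk φ π 1) ⊓
        invariants (σ.comp J.subtype))
      ↑(LinearMap.range (e.toLinearEquiv.symm.toLinearMap ∘ₗ IndV.mk φ π 1) ⊓
        invariants (σ.comp J.subtype)) := by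
  rintro w ⟨⟨a, rfl⟩, hw⟩
  have ha : a ∈ invariants (π.comp (J.comap φ).subtype) :=
    mem_invariants_comap_of_mem_invariants φ π σ e hφ J hw
  have hxa := hx ha
  have heq : σ (φ x) ((e.toLinearEquiv.symm.toLinearMap ∘ₗ IndV.mk φ π 1) a) =
      (e.toLinearEquiv.symm.toLinearMap ∘ₗ IndV.mk φ π 1) (π x a) :=
    (LinearMap.congr_fun (comp_indV_mk_one_intertwines φ π σ e x) a).symm
  refine ⟨⟨π x a, heq.symm⟩, ?_⟩
  change σ (φ x) _ ∈ invariants (σ.comp J.subtype)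
  rw [heq]
  exact mem_invariants_of_mem_invariants_comap φ π σ e J hJ hxa

/-- `φ⁻¹(φ(G) ∩ J) = φ⁻¹(J)`. [folklore] -/
theorem comap_range_inf (J : Subgroup H) : (φ.range ⊓ J).comap φ = J.comap φ := by
  ext g
  simp only [Subgroup.mem_comap, Subgroup.mem_inf, MonoidHom.mem_range, exists_apply_eq_apply,
    true_and]

end Transport

/-! ### Bookkeeping in `D`: the shape of the Frobenius hypothesis -/

section Frobenius

variable {H : Type*} [Group H] {D I : Subgroup H} {fr : H}

/-- If `I` is normalised by `D` and `fr ∈ D`, an element `x` with `τ x τ⁻¹ ∈ I · fr^n` (written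
`τ x τ⁻¹ (fr^n)⁻¹ ∈ I`, the form in which Frobenius elements of a subextension are compared
with powers of a Frobenius downstairs) is of the form `τ⁻¹ (fr^n y) τ` with `y ∈ I` — the
shape of the hypotheses `hs`, `hf` of
`reverse_charpoly_restrict_invariants_eq_prod_of_equiv_ind`. [folklore] -/
theorem exists_eq_inv_mul_pow_mul_of_mem (hIn : ∀ d ∈ D, ∀ y ∈ I, d⁻¹ * y * d ∈ I)
    (hfr : fr ∈ D) {x τ : H} {n : ℕ} (h : τ * x * τ⁻¹ * (fr ^ n)⁻¹ ∈ I) :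
    ∃ y ∈ I, x = τ⁻¹ * (fr ^ n * y * τ) :=
  ⟨(fr ^ n)⁻¹ * (τ * x * τ⁻¹ * (fr ^ n)⁻¹) * fr ^ n, hIn _ (D.pow_mem hfr n) _ h, by group⟩

/-- Conversely, `x = τ⁻¹ (fr^n y) τ` with `y ∈ I` gives `τ x τ⁻¹ (fr^n)⁻¹ ∈ I`. [folklore] -/
theorem conj_mul_pow_inv_mem_of_eq (hIn : ∀ d ∈ D, ∀ y ∈ I, d⁻¹ * y * d ∈ I)
    (hfr : fr ∈ D) {x τ y : H} {n : ℕ} (hy : y ∈ I) (h : x = τ⁻¹ * (fr ^ n * y * τ)) :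
    τ * x * τ⁻¹ * (fr ^ n)⁻¹ ∈ I := by
  have hmem : (fr ^ n)⁻¹⁻¹ * y * (fr ^ n)⁻¹ ∈ I := hIn _ (D.inv_mem (D.pow_mem hfr n)) _ hy
  rw [h]
  convert hmem using 1
  group

end Frobenius

/-! ### The main theorem for `σ ≃ Ind_φ π` -/

section EquivInd

variable {k : Type*} [Field k] [CharZero k] {G H : Type*} [Group G] [Group H] (φ : G →* H)
  {A W : Type*} [AddCommGroup A] [Module k A] [FiniteDimensional k A]
  [AddCommGroup W] [Module k W] [FiniteDimensional k W]
  (π : Representation k G A) (σ : Representation k H W)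
  {D I : Subgroup H} {fr : H} {ι : Type*} [Fintype ι] (τ : ι → H) (f : ι → ℕ) (s : ι → G)
  (N : Subgroup H) [N.Normal] [N.FiniteIndex]

/-- **Artin's theorem on the Euler factor of an induced representation, for `σ ≃ Ind_φ π`.**
Let `φ : G →* H` be injective with image of finite index, `π`, `σ` finite-dimensional
representations of `G` on `A` and of `H` on `W` over a field of characteristic `0`, and
`e : σ ≃ ind φ π` (Mathlib `Representation.Equiv`, `Representation.ind`).  Let `N ⊴ H` be of
finite index and act trivially through `σ`; `I ≤ D ≤ H` with `I` normalised by `D`; `fr ∈ D`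
such that every `d ∈ D` lies in `fr^a I N` (`hgen`); `τ : ι → H` representatives of the double
cosets `D \ H / φ(G)` (`h1`, `h2`); `s : ι → G` and `f : ι → ℕ` with
`φ(sᵢ) ∈ τᵢ⁻¹ fr^{fᵢ} I τᵢ` (`hs`) and `fᵢ ∣ m` whenever `τᵢ⁻¹ fr^m I τᵢ` meets `φ(G)` (`hf`).
Then
`det(1 - t σ(fr) | W^{I}) = ∏ᵢ det(1 - t^{fᵢ} π(sᵢ) | A^{φ⁻¹(τᵢ⁻¹ I τᵢ)})`
(`Polynomial.expand`, reversed characteristic polynomials of the restrictions).  This is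
`reverse_charpoly_restrict_invariants_eq_prod_of_quotient` for the Serre datum
`(σ, φ(G), W₀ = e⁻¹(1 ⊗ A))` of `InducedDimension`, with the factors transported to `A`
(`charpoly_restrict_comap_eq`); if `A = 0` both sides are `1`.
[cite: NeukirchANT1999, VII (10.4) (iv), proof pp. 523–524] [cite: ArtinHamburg1931, §2] -/
theorem reverse_charpoly_restrict_invariants_eq_prod_of_equiv_ind (e : σ.Equiv (ind φ π))
    (hφ : Function.Injective φ) [φ.range.FiniteIndex]
    (hNσ : ∀ n ∈ N, σ n = 1)
    (hID : I ≤ D) (hIn : ∀ d ∈ D, ∀ y ∈ I, d⁻¹ * y * d ∈ I) (hfr : fr ∈ D)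
    (hgen : ∀ d ∈ D, ∃ a : ℕ, ∃ y ∈ I, (fr ^ a * y)⁻¹ * d ∈ N)
    (h1 : ∀ x : H, ∃ i, ∃ d ∈ D, ∃ g : G, x = d * τ i * φ g)
    (h2 : ∀ i j, (∃ d ∈ D, ∃ g : G, τ j = d * τ i * φ g) → i = j)
    (hs : ∀ i, ∃ y ∈ I, φ (s i) = (τ i)⁻¹ * (fr ^ f i * y * τ i))
    (hf : ∀ i (m : ℕ), (∃ y ∈ I, ∃ g : G, φ g = (τ i)⁻¹ * (fr ^ m * y * τ i)) → f i ∣ m)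
    (hA : Set.MapsTo (σ fr) ↑(invariants (σ.comp I.subtype)) ↑(invariants (σ.comp I.subtype)))
    (hB : ∀ i, Set.MapsTo (π (s i))
      ↑(invariants (π.comp ((I.comap (MulAut.conj (τ i)).toMonoidHom).comap φ).subtype))
      ↑(invariants (π.comp ((I.comap (MulAut.conj (τ i)).toMonoidHom).comap φ).subtype))) :
    ((σ fr).restrict hA).charpoly.reverse =
      ∏ i, Polynomial.expand k (f i) ((π (s i)).restrict (hB i)).charpoly.reverse := by
  classical
  -- the Serre datum `(σ, φ(G), W₀ = i(A))`
  set Hs : Subgroup H := φ.range with hHs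
  set iW : A →ₗ[k] W := e.toLinearEquiv.symm.toLinearMap ∘ₗ IndV.mk φ π 1 with hiW
  let W₀ : Subrepresentation (σ.comp Hs.subtype) :=
    { toSubmodule := LinearMap.range iW
      apply_mem_toSubmodule := fun h w hw => apply_mem_range_comp_indV_mk_one φ π σ e h.2 hw }
  have hW₀ : W₀.toSubmodule = LinearMap.range iW := rfl
  have hspan : ⨆ g : H, W₀.toSubmodule.map (σ g) = ⊤ := iSup_map_range_comp_indV_mk_one φ π σ e
  have hdim : Module.finrank k W = Hs.index * Module.finrank k W₀.toSubmodule :=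
    finrank_eq_index_mul_finrank_range φ π σ e hφ
  -- the subgroups `Jᵢ = φ(G) ∩ τᵢ⁻¹ I τᵢ` and their preimages
  have hJ : ∀ i, (Hs ⊓ I.comap (MulAut.conj (τ i)).toMonoidHom).comap φ =
      (I.comap (MulAut.conj (τ i)).toMonoidHom).comap φ := fun i => comap_range_inf φ _
  have hinv : ∀ i, invariants (π.comp ((Hs ⊓ I.comap (MulAut.conj (τ i)).toMonoidHom).comap
      φ).subtype) = invariants (π.comp ((I.comap (MulAut.conj (τ i)).toMonoidHom).comap
      φ).subtype) := fun i =>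
    congrArg (fun S : Subgroup G => invariants (π.comp S.subtype)) (hJ i)
  have hB₁ : ∀ i, Set.MapsTo (π (s i))
      ↑(invariants (π.comp ((Hs ⊓ I.comap (MulAut.conj (τ i)).toMonoidHom).comap φ).subtype))
      ↑(invariants (π.comp ((Hs ⊓ I.comap (MulAut.conj (τ i)).toMonoidHom).comap
        φ).subtype)) := fun i => by
    rw [hinv i]; exact hB i
  have hB₂ : ∀ i, Set.MapsTo (σ (φ (s i)))
      ↑(W₀.toSubmodule ⊓ invariants (σ.comp (Hs ⊓ I.comap (MulAut.conj (τ i)).toMonoidHom).subtype))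
      ↑(W₀.toSubmodule ⊓ invariants
        (σ.comp (Hs ⊓ I.comap (MulAut.conj (τ i)).toMonoidHom).subtype)) := fun i =>
    mapsTo_inf_invariants_range φ π σ e hφ _ inf_le_left (s i) (hB₁ i)
  -- the factors, transported to `A`
  have hfac : ∀ i, ((σ (φ (s i))).restrict (hB₂ i)).charpoly =
      ((π (s i)).restrict (hB i)).charpoly := fun i => by
    rw [← charpoly_restrict_comap_eq φ π σ e hφ (Hs ⊓ I.comap (MulAut.conj (τ i)).toMonoidHom)
      inf_le_left (s i) (hB₁ i) (hB₂ i)]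
    exact charpoly_restrict_congr (hinv i) rfl _ _
  by_cases hA0 : W₀.toSubmodule = ⊥
  · -- degenerate case: `A = 0`, `W = 0`, all polynomials are `1`
    have hW : Module.finrank k W = 0 := by rw [hdim, hA0, finrank_bot, mul_zero]
    have hAA : Module.finrank k A = 0 := by
      rw [← LinearMap.finrank_range_of_inj (comp_indV_mk_one_injective φ π σ e hφ), ← hiW,
        ← hW₀, hA0, finrank_bot]
    rw [reverse_charpoly_restrict_eq_one_of_finrank_eq_zero hW]
    symm
    refine Finset.prod_eq_one fun i _ => ?_
    rw [reverse_charpoly_restrict_eq_one_of_finrank_eq_zero hAA, map_one]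
  -- generic case: `N ≤ φ(G)` and the quotient form of Artin's theorem applies
  have hNH : N ≤ Hs := fun n hn => mem_of_apply_eq_one σ Hs W₀ hspan hdim hA0 (hNσ n hn)
  have h1' : ∀ x : H, ∃ i, ∃ d ∈ D, ∃ h ∈ Hs, x = d * τ i * h := fun x => by
    obtain ⟨i, d, hd, g, rfl⟩ := h1 x
    exact ⟨i, d, hd, φ g, ⟨g, rfl⟩, rfl⟩
  have h2' : ∀ i j, (∃ d ∈ D, ∃ h ∈ Hs, τ j = d * τ i * h) → i = j := by
    rintro i j ⟨d, hd, _, ⟨g, rfl⟩, hEq⟩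
    exact h2 i j ⟨d, hd, g, hEq⟩
  have hφ'H : ∀ i, φ (s i) ∈ Hs := fun i => ⟨s i, rfl⟩
  have hf' : ∀ i (m : ℕ), (∃ y ∈ I, (τ i)⁻¹ * (fr ^ m * y * τ i) ∈ Hs) → f i ∣ m := by
    rintro i m ⟨y, hy, g, hg⟩
    exact hf i m ⟨y, hy, g, hg⟩
  have main := reverse_charpoly_restrict_invariants_eq_prod_of_quotient σ Hs W₀ τ f
    (fun i => φ (s i)) N hNσ hNH hspan hdim hID hIn hfr hgen h1' h2' hφ'H hs hf' hA hB₂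
  rw [main]
  exact Finset.prod_congr rfl fun i _ => by rw [hfac i]

end EquivInd

end Literature.RepresentationTheory.FiniteGroups
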